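import Summits.Ventures.DiscreteObjects.PP12.PrimeOrderAtlas
import Literature.Combinatorics.Designs.ProjectivePlaneOrder12Collineations

/-!
# PP(12): the two live cells as typed census statements, and "cells empty ⇒ every collineation group is trivial"
Framing: lottery ticket; floor = certified bounds/negative ranges.

The census cell `pub-namedobj` (target M, family B1) has reduced the assumed-symmetry search for a projective plane of order 12
to two LIVE cells (NAMEDOBJ-TABLE §M; kernel typing in `PrimeOrderAtlas`, p223443): a single involution (necessarily an elation,
`Involution.lean`) and a single collineation of order 3 (elation — excluded in print — / planar of order 3 / flag type,
`OrderThree.lean`). This file TYPES the two census statements that would close them — `NoInvolutionOrder12`,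
`NoOrderThreeOrder12` (named `Prop`s; NOT proved; they are the cell's own census targets, not literature facts) — and proves
the typed endgame (`card_collineationGroup_eq_one_of_cells_empty`): GIVEN the printed theorem that the full collineation group
of a plane of order 12 is a `{2,3}`-group (named fact `CollineationGroupIsTwoThreeGroup`, Janko–van Trung 1982, p218794) and the
two census statements, EVERY collineation group of a projective plane of order 12 is trivial (a putative PP(12) would be rigid).
Proof: Cauchy's theorem gives an element of prime order `p ∣ |G|`, `p ∈ {2,3}` by the named fact, and the element induces a
`Collineation` with `σ^p = 1`, `σ ≠ 1` (faithful action), contradicting the corresponding census statement. Conditional on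
exactly the three hypotheses; nothing else is assumed.
-/

namespace Summit.Ventures.DiscreteObjects.PP12

open Configuration Literature.Combinatorics.Designs

/-- **Census statement, live cell |G| = 2 (typed, NOT proved):** no projective plane of order 12 admits an involution
(equivalently, by `elation_of_sq`, an involutory elation). Family F-INV2 reduces it to 'no STD₂[12;6] has a consistent GF(2) lift'. -/
def NoInvolutionOrder12 : Prop :=
  ∀ (P L : Type) [Membership P L] [Fintype P] [Fintype L] [ProjectivePlane P L],
    ProjectivePlane.order P L = 12 → ∀ σ : Collineation P L, σ.onPoints ^ 2 = 1 → σ.onPoints = 1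

/-- **Census statement, live cell |G| = 3 (typed, NOT proved):** no projective plane of order 12 admits a collineation of order 3
(by `order_three_structure` it would be an elation — excluded in print —, planar of order 3, or of flag type). -/
def NoOrderThreeOrder12 : Prop :=
  ∀ (P L : Type) [Membership P L] [Fintype P] [Fintype L] [ProjectivePlane P L],
    ProjectivePlane.order P L = 12 → ∀ σ : Collineation P L, σ.onPoints ^ 3 = 1 → σ.onPoints = 1

/-- A group element of a collineation group induces a `Collineation`. -/
def Collineation.ofSMul {G P L : Type*} [Group G] [Membership P L] [MulAction G P] [MulAction G L]
    (h : ∀ (g : G) (p : P) (l : L), p ∈ l ↔ g • p ∈ g • l) (g : G) : Collineation P L where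
  onPoints := MulAction.toPerm g
  onLines := MulAction.toPerm g
  mem_iff := fun p l => by simpa using (h g p l).symm

/-- The point action of `ofSMul g` is `toPerm g`. -/
@[simp] theorem Collineation.ofSMul_onPoints {G P L : Type*} [Group G] [Membership P L] [MulAction G P] [MulAction G L]
    (h : ∀ (g : G) (p : P) (l : L), p ∈ l ↔ g • p ∈ g • l) (g : G) :
    (Collineation.ofSMul h g).onPoints = MulAction.toPerm g := rfl

/-- **Cells empty ⇒ rigid.** Given the Janko–van Trung `{2,3}`-group theorem (named fact) and the two census statements, every
collineation group of a projective plane of order 12 is trivial. -/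
theorem card_collineationGroup_eq_one_of_cells_empty (hJvT : CollineationGroupIsTwoThreeGroup)
    (h2 : NoInvolutionOrder12) (h3 : NoOrderThreeOrder12)
    (P L : Type) [Membership P L] [Fintype P] [Fintype L] [ProjectivePlane P L] (h12 : ProjectivePlane.order P L = 12)
    (G : Type) [Group G] [Fintype G] [MulAction G P] [MulAction G L] (hG : IsCollineationGroup G P L) :
    Fintype.card G = 1 := by
  by_contra hcard
  obtain ⟨p, hp, hpd⟩ := Nat.exists_prime_and_dvd hcard
  haveI : Fact p.Prime := ⟨hp⟩
  obtain ⟨g, hg⟩ := exists_prime_orderOf_dvd_card p hpd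
  have hp23 := hJvT P L h12 G hG p hp hpd
  -- the induced collineation has σ^p = 1 and σ ≠ 1
  haveI : FaithfulSMul G P := hG.1
  set σ := Collineation.ofSMul hG.2 g with hσ
  have hpow : σ.onPoints ^ p = 1 := by
    rw [hσ, Collineation.ofSMul_onPoints, ← MulAction.coe_toPermHom, ← map_pow, ← hg, pow_orderOf_eq_one, map_one]
  have hne : σ.onPoints ≠ 1 := by
    intro h1
    have hg1 : g = 1 := by
      apply MulAction.toPerm_injective (α := G) (β := P)
      rw [hσ, Collineation.ofSMul_onPoints] at h1
      rw [h1]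
      ext x; simp
    rw [hg1, orderOf_one] at hg
    exact hp.one_lt.ne' hg.symm
  rcases hp23 with rfl | rfl
  · exact hne (h2 P L h12 σ hpow)
  · exact hne (h3 P L h12 σ hpow)

/-- What the kernel says the cells ARE (pointer theorem): under `NoInvolutionOrder12`'s negation there is an involutory ELATION
(13 fixed points); under `NoOrderThreeOrder12`'s negation there is a collineation of order 3 of one of the three types of
`order_three_structure`. Stated as the contrapositive-friendly form: any `σ ≠ 1` with `σ² = 1` is an elation. -/
theorem involution_cell_is_elation (P L : Type) [Membership P L] [Fintype P] [Fintype L] [ProjectivePlane P L]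
    (h12 : ProjectivePlane.order P L = 12) (σ : Collineation P L) (hq : σ.onPoints ^ 2 = 1) (hne : σ.onPoints ≠ 1) :
    ∃ (l : L) (c : P), σ.IsAxis l ∧ σ.IsCenter c ∧ c ∈ l := by
  classical
  exact σ.elation_of_sq h12 hne hq

end Summit.Ventures.DiscreteObjects.PP12
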